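import Summits.NavierStokesRegularity.NavierStokesRegularity.Theses.StretchingWellBinding
import Summits.NavierStokesRegularity.NavierStokesRegularity.Theses.TypeILiouville
import Summits.NavierStokesRegularity.NavierStokesRegularity.Theses.TypeIQuarterGate
import Literature.Analysis.FunctionSpaces.WeakLp
import Summits.NavierStokesRegularity.NavierStokesRegularity.Theorems.LerayQuarterDissipationRecordTimeTypeI
import Summits.NavierStokesRegularity.NavierStokesRegularity.Theorems.StretchingWellBindingEnstrophyQuarterLawVolumeSparse
import Summits.NavierStokesRegularity.NavierStokesRegularity.Theorems.StretchingWellBindingEnstrophyQuarterLawFastSetBudget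
import Summits.NavierStokesRegularity.NavierStokesRegularity.Theorems.StretchingWellBindingEnstrophyQuarterLawVorticityTypeI
import Summits.NavierStokesRegularity.NavierStokesRegularity.Theorems.StretchingWellBindingEnstrophyQuarterLawLambSlaving
import Literature.Analysis.FluidPDE.VectorCalculus
import HarnessLib.Audit

/-!
# Line «lamb_budget» on the shelf crux `StretchingWellBinding.EnstrophyQuarterLaw` (stmt-NavierStokesRegularity-1574)

LINE 7 of seat ns-idea-9 (generation 3, lens «wuc»). A line ON the crux itself. It identifies the
weakest unknown consequence of the quarter law that, together with the Type-I wall, gives it back: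

  `EnstrophyQuarterLaw  ⟺  (sup-rate Type I, stmt-0056 per solution)  ∧  VOLUME SPARSENESS OF THE FAST SET`

where the FAST SET at time `s` is the velocity super-level set at the self-similar threshold,
`F_{c₀}(s) = {x : |u(x,s)| > c₀ √(ν/(T−s))}`, and VOLUME SPARSENESS says it occupies boundedly many
parabolic cells BY LEBESGUE MEASURE: `|F_{c₀}(s)| ≤ N (ν(T−s))^{3/2}` on `[0,T)`, for some `c₀ < 1`.

**The lever (Bernoulli–Lamb balance + threshold absorption).** Along a classical solution,
`½ dZ/dt = −ν P + S` with `Z = ∫|curl u|²`, `P = ∫|∇ curl u|² = ∫|Δu|²` and — because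
`(u·∇)u = (curl u) × u + ∇|u|²/2` and the Bernoulli head is invisible to the divergence-free `Δu` —
`S = ⟨Δu, ω × u⟩`: the stretching term IS the pairing of `Δu` with the LAMB VECTOR `ℓ = ω × u`. Hence
`|S| ≤ P^{1/2}‖ℓ‖₂` and, by AM–GM against the dissipation, `dZ/dt ≤ ‖ℓ(s)‖²₂/(2ν)`: the enstrophy is
SLAVED to the space–time `L²` budget of a first-order quantity whose density
`|ω × u|² = |u|²|ω|² sin²∠(u,ω)` charges only MISALIGNED, DOUBLY-INTENSE regions. Split `ℓ` at the
threshold `|u| = c₀√(ν/(T−s))`: the slow part costs `≤ c₀²ν(T−s)⁻¹Z`, which the integrating factor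
`(T−s)^{c₀²/2}` absorbs — harmlessly iff `c₀²/2 < 1/2`, i.e. iff `c₀ < 1` — so ONLY THE FAST SET IS
CHARGED (`stub_enstrophySlavedToIntenseLamb`, provable, M):

  `Z(t) ≤ Z(0)(T/(T−t))^{c₀²/2} + (2ν(1−c₀²))⁻¹ · sup_{s≤t} √(T−s)·𝔏_{c₀}(s) / √(T−t)`,
  `𝔏_{c₀}(t) = ∫₀ᵗ ∫_{F_{c₀}(s)} |ω × u|² dx ds`  (the super-threshold Lamb budget).

On the fast set, sup-rate Type I for `u` (stmt-0056) and for `ω` (KNOWN consequence: parabolic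
regularity of bounded solutions, Pineau–Vicol-type cylinder estimate in tree) give
`|ω × u|² ≤ M²M_ω² ν (T−s)⁻³`, so `∫_{F}|ω×u|² ≤ |F(s)| · M²M_ω²ν(T−s)⁻³ ≤ N M²M_ω² ν^{5/2}(T−s)^{−3/2}`,
whose time integral is the quarter law (`stub_fastSetBudget`, provable, S/M). Conversely the quarter law
forces Type I (PROVED record-time lemma `LerayQuarterDissipation.RecordTimeTypeI`, stmt-22145) and forces
volume sparseness at EVERY threshold by Sobolev–Chebyshev: `|F_{c₀}(s)| ≤ ‖u‖⁶_{L⁶}/λ⁶ ≤ C_S⁶ Z³/λ⁶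
≤ (C_S⁶K³/c₀⁶ν^{9/2})·(ν(T−s))^{3/2}` (`stub_volumeSparseOfSlice`, provable, S/M). So nothing is lost:
per solution and for every `c₀ ∈ (0,1)`, `SliceLaw ⟺ IsTypeIBlowup ∧ VolumeSparse c₀` (`sliceLaw_iff`).

**What is new / why easier.** Energy alone gives `|F_{c₀}(s)| ≤ 2E₀(T−s)/(c₀²ν)` — one power
`(T−s)^{1/2}` short; the quarter law is EXACTLY that missing half power, now carried by a Lebesgue-measure
statement about a velocity super-level set (no derivative, no ε-regularity, no CKN currency, no finite
singular set, no envelope): the weakest typed consequence of `EnstrophyQuarterLaw` not known (lens «wuc»),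
used toward it through the Type-I wall it shares with every line on this shelf. The threshold `c₀ = 1` is
sharp in the absorption and is the SAME constant as the dss cell's threshold Liouville
`typeI_ancient_eq_zero_of_timeConstant_lt_one_noDecay`; corollary (M, recorded in the card, not a stub):
every blow-up has `limsup_{t→T} (T−t)‖u(t)‖²_∞ ≥ ν` (empty fast set for some `c₀<1` near `T` ⇒
`Z ≲ (T−t)^{−c₀²/2}`, contradicting Leray's floor `leray_blowup_rate_enstrophy`).
**Corollary for route TypeIQuarterGate (PROVED glue, this file).** A uniform weak-`L³` bound is volume
sparseness at EVERY threshold (one level of Chebyshev: `volumeSparse_of_weakL3`, no `sorry`), so TIQG's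
deciding crux `QuarterLawTypeI` (stmt-23726) follows from ITS OWN rank-4 crux `LorentzUpgradeTypeI`
(stmt-24108: Type I ⇒ `sup_t ‖u(t)‖_{L^{3,∞}} < ∞`) and the three provable/known stubs 1, 3, 5 DIRECTLY
(`quarterLawTypeI_of_lorentzUpgrade`) — no scar count (23842), no scar envelope (23843), no profile, no
Liouville: the layer «LorentzUpgrade → ProfileEnvelope → QuarterLawTypeI» of that route collapses to
«LorentzUpgrade → (Chebyshev) VolumeSparse → (Lamb slaving) QuarterLawTypeI».
No summit is proved by this line; `EnstrophyQuarterLaw`, stmt-0056, stmt-24108 and `VolumeSparsenessLaw`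
stay OPEN.

`lean check`: rc 0, `sorry` exactly in the six `stub_*`; `volumeSparse_of_weakL3` and all compositions are real proofs.

**BY-NAME RETIREMENT (ns-hhe-c1 g3, 2026-08-28).** Stubs 1, 3, 5, 6 are now `import` + reference to the
landed Theorems theorems with these signatures verbatim (namespace
`Summit.NavierStokesRegularity.NavierStokesRegularity.Theorems.EnstrophyQuarterLaw.LambBudget`):
`enstrophySlavedToIntenseLamb` (p624383, file `…Theorems/StretchingWellBindingEnstrophyQuarterLawLambSlaving.lean`),
`vorticityTypeIOfTypeI` (p621875, `…VorticityTypeI.lean`), `fastSetBudget` (p621507, `…FastSetBudget.lean`),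
`volumeSparseOfSlice` (p621487, `…VolumeSparse.lean`); the corollary `quarterLawTypeI_of_lorentzUpgrade :
LorentzUpgradeTypeI → QuarterLawTypeI` is landed UNCONDITIONALLY in the three provable stubs as
`…Theorems.EnstrophyQuarterLaw.LambBudget.quarterLawTypeI_of_lorentzUpgrade` (p625040,
`…Theorems/StretchingWellBindingEnstrophyQuarterLawLambBudgetAssembly.lean`). `lean check` now: rc 0,
`sorry` exactly in `stub_noTypeII` (= stmt-0056, open) and `stub_volumeSparseness` (= thesis B, open).
No summit statement is proved; `EnstrophyQuarterLaw` (1574), 0056, 24108, B stay OPEN.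
-/

set_option linter.dupNamespace false
set_option linter.unusedVariables false

noncomputable section

open MeasureTheory Set
open scoped ENNReal NNReal

namespace Summit.NavierStokesRegularity.NavierStokesRegularity.Cruxes.EnstrophyQuarterLaw.LambBudget

open Literature.Analysis.FluidPDE

/-! ### Objects -/

/-- The FAST SET at time `s`: where the speed exceeds `c₀ ×` the self-similar rate `√(ν/(T−s))`. -/
def fastSet (c₀ ν T : ℝ) (u : ℝ → EuclideanSpace ℝ (Fin 3) → EuclideanSpace ℝ (Fin 3)) (s : ℝ) :
    Set (EuclideanSpace ℝ (Fin 3)) :=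
  {x | c₀ * Real.sqrt (ν / (T - s)) < ‖u s x‖}

/-- The **super-threshold Lamb budget** `𝔏_{c₀}(t) = ∫₀ᵗ ∫_{F_{c₀}(s)} |curl u(s,x) × u(s,x)|² dx ds`
(extended real; `|ω × u|² = |u|²|ω|² sin²∠(u,ω)`). -/
def intenseLambBudget (c₀ ν T : ℝ) (u : ℝ → EuclideanSpace ℝ (Fin 3) → EuclideanSpace ℝ (Fin 3))
    (t : ℝ) : ℝ≥0∞ :=
  ∫⁻ s in Set.Ioo 0 t, ∫⁻ x in fastSet c₀ ν T u s, ‖cross (curl (u s) x) (u s x)‖ₑ ^ 2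

/-- For one solution: the Lamb-budget quarter law at threshold `c₀`. -/
def IntenseLambLaw (c₀ ν T : ℝ) (u : ℝ → EuclideanSpace ℝ (Fin 3) → EuclideanSpace ℝ (Fin 3)) : Prop :=
  ∃ K : ℝ, ∀ t ∈ Set.Ico 0 T, intenseLambBudget c₀ ν T u t ≤ ENNReal.ofReal (K / Real.sqrt (T - t))

/-- For one solution: the slice quarter law (literally the conclusion of `EnstrophyQuarterLaw`). -/
def SliceLaw (T : ℝ) (u : ℝ → EuclideanSpace ℝ (Fin 3) → EuclideanSpace ℝ (Fin 3)) : Prop :=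
  ∃ K : ℝ, ∀ t ∈ Set.Ico 0 T, ∫⁻ x, ‖curl (u t) x‖ₑ ^ 2 ≤ ENNReal.ofReal (K / Real.sqrt (T - t))

/-- For one solution: **volume sparseness** of the fast set at threshold `c₀` — it occupies at most `N`
parabolic cells `(ν(T−s))^{3/2}` BY LEBESGUE MEASURE (energy alone gives only `O((T−s))`). -/
def VolumeSparse (c₀ ν T : ℝ) (u : ℝ → EuclideanSpace ℝ (Fin 3) → EuclideanSpace ℝ (Fin 3)) : Prop :=
  ∃ N : ℝ, ∀ s ∈ Set.Ico 0 T, volume (fastSet c₀ ν T u s) ≤ ENNReal.ofReal (N * Real.sqrt (ν * (T - s)) ^ 3)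

/-- For one solution: sup-rate Type I for the VORTICITY near `T`. -/
def VorticityTypeI (T : ℝ) (u : ℝ → EuclideanSpace ℝ (Fin 3) → EuclideanSpace ℝ (Fin 3)) : Prop :=
  ∃ C : ℝ, ∀ᶠ t in nhdsWithin T (Set.Iio T), ∀ x, ‖curl (u t) x‖ ≤ C / (T - t)

/-! ### Statements -/

/-- THE NEW CRUX `B` (OPEN; lens «wuc»: a consequence of `EnstrophyQuarterLaw` — hence of the summit — not
known, strictly between the energy bound `O(T−s)` and the quarter law): for SOME threshold `c₀ ∈ (0,1)`, at
every first blow-up of a classical Leray–Hopf solution from a rapidly decaying datum the fast set is volume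
sparse. (`∃ c₀ < 1`, not a hand-picked constant: checklist 4c(iv).) -/
def VolumeSparsenessLaw : Prop :=
  ∃ c₀ : ℝ, 0 < c₀ ∧ c₀ < 1 ∧
    ∀ (ν T : ℝ), 0 < ν → 0 < T →
      ∀ (u : ℝ → EuclideanSpace ℝ (Fin 3) → EuclideanSpace ℝ (Fin 3)) (p : ℝ → EuclideanSpace ℝ (Fin 3) → ℝ),
      IsMaximalSmoothSolution ν 0 u p T → IsLerayHopfOn T ν 0 (u 0) u → HasRapidSpatialDecay (u 0) →
      VolumeSparse c₀ ν T u

/-- INTERMEDIATE NODE `C⁺` (equivalent to `EnstrophyQuarterLaw`; derived below, not a stub): the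
super-threshold Lamb-budget quarter law for some `c₀ ∈ (0,1)`. -/
def LambBudgetQuarterLaw : Prop :=
  ∃ c₀ : ℝ, 0 < c₀ ∧ c₀ < 1 ∧
    ∀ (ν T : ℝ), 0 < ν → 0 < T →
      ∀ (u : ℝ → EuclideanSpace ℝ (Fin 3) → EuclideanSpace ℝ (Fin 3)) (p : ℝ → EuclideanSpace ℝ (Fin 3) → ℝ),
      IsMaximalSmoothSolution ν 0 u p T → IsLerayHopfOn T ν 0 (u 0) u → HasRapidSpatialDecay (u 0) →
      IntenseLambLaw c₀ ν T u

/-- SLAVING (provable, M): for every `c₀ ∈ (0,1)` the super-threshold Lamb-budget law implies the slice law.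
`dZ/dt = 2⟨Δu, ω×u⟩ − 2ν∫|Δu|² ≤ ‖ω×u‖²₂/(2ν)`; slow part `≤ c₀²ν(T−s)⁻¹Z` absorbed by `(T−s)^{c₀²/2}`
(`c₀²/2 < 1/2`); Tonelli in `s` against the cumulative budget. Leans on `EfficiencyFloor.EnstrophyBudget`
(stmt-22995, PROVED: `Z′ = 2S − 2νP`), whole-space IBP for `S = ⟨Δu, (curl u) × u⟩`, `Z(0) < ∞`. -/
def EnstrophySlavedToIntenseLamb : Prop :=
  ∀ c₀ : ℝ, 0 < c₀ → c₀ < 1 →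
    ∀ (ν T : ℝ), 0 < ν → 0 < T →
      ∀ (u : ℝ → EuclideanSpace ℝ (Fin 3) → EuclideanSpace ℝ (Fin 3)) (p : ℝ → EuclideanSpace ℝ (Fin 3) → ℝ),
      IsMaximalSmoothSolution ν 0 u p T → IsLerayHopfOn T ν 0 (u 0) u → HasRapidSpatialDecay (u 0) →
      IntenseLambLaw c₀ ν T u → SliceLaw T u

/-- KNOWN (M–L to vendor; parabolic regularity of bounded classical solutions on cylinders of size `√(T−s)`,
e.g. the tree's `PineauVicol2026.exists_forall_iteratedFDeriv_le_of_bounded` with the local pressure mass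
bound, or Giga–Inui–Matsui `L^∞` smoothing): sup-rate Type I for `u` ⇒ sup-rate Type I for `curl u`. -/
def VorticityTypeIOfTypeI : Prop :=
  ∀ (ν T : ℝ), 0 < ν → 0 < T →
    ∀ (u : ℝ → EuclideanSpace ℝ (Fin 3) → EuclideanSpace ℝ (Fin 3)) (p : ℝ → EuclideanSpace ℝ (Fin 3) → ℝ),
    IsMaximalSmoothSolution ν 0 u p T → IsLerayHopfOn T ν 0 (u 0) u → HasRapidSpatialDecay (u 0) →
    IsTypeIBlowup u T → VorticityTypeI T u

/-- FAST-SET BUDGET (provable, S/M): Type I for `u` and `curl u` near `T` + volume sparseness at `c₀` ⇒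
the Lamb-budget law at `c₀` (`|ω×u|² ≤ |u|²|ω|²` on the fast set, measure × sup; early times by
boundedness of the classical solution on closed sub-slabs; `∫₀ᵗ(T−s)^{−3/2}ds ≤ 2/√(T−t)`). -/
def FastSetBudget : Prop :=
  ∀ c₀ : ℝ, 0 < c₀ →
    ∀ (ν T : ℝ), 0 < ν → 0 < T →
      ∀ (u : ℝ → EuclideanSpace ℝ (Fin 3) → EuclideanSpace ℝ (Fin 3)) (p : ℝ → EuclideanSpace ℝ (Fin 3) → ℝ),
      IsMaximalSmoothSolution ν 0 u p T → IsLerayHopfOn T ν 0 (u 0) u → HasRapidSpatialDecay (u 0) →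
      IsTypeIBlowup u T → VorticityTypeI T u → VolumeSparse c₀ ν T u → IntenseLambLaw c₀ ν T u

/-- CONVERSE (provable, S/M; Sobolev `H¹ ⊂ L⁶` + Chebyshev): the slice law forces volume sparseness at EVERY
threshold `c₀ > 0`, with `N = C_S⁶ K³ c₀⁻⁶ ν^{−9/2}`. -/
def VolumeSparseOfSlice : Prop :=
  ∀ c₀ : ℝ, 0 < c₀ →
    ∀ (ν T : ℝ), 0 < ν → 0 < T →
      ∀ (u : ℝ → EuclideanSpace ℝ (Fin 3) → EuclideanSpace ℝ (Fin 3)) (p : ℝ → EuclideanSpace ℝ (Fin 3) → ℝ),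
      IsMaximalSmoothSolution ν 0 u p T → IsLerayHopfOn T ν 0 (u 0) u → HasRapidSpatialDecay (u 0) →
      SliceLaw T u → VolumeSparse c₀ ν T u

/-! ### Registered stubs -/

/-- STUB 1 (provable, M — the slaving inequality with threshold absorption; the line's engine).
CLOSED by name (ns-hhe-c1 g3, p624383): the landed Theorems theorem with this signature verbatim. -/
theorem stub_enstrophySlavedToIntenseLamb : EnstrophySlavedToIntenseLamb :=
  Summit.NavierStokesRegularity.NavierStokesRegularity.Theorems.EnstrophyQuarterLaw.LambBudget.enstrophySlavedToIntenseLamb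

/-- STUB 2 (OPEN, XL — the Type-I wall, sibling crux stmt-NavierStokesRegularity-0056 BY NAME; shared with
`Lines/birth.lean`, `Lines/window_average.lean`, `Lines/sparse_sieve.lean`). -/
theorem stub_noTypeII :
    Summit.NavierStokesRegularity.NavierStokesRegularity.Theses.TypeILiouville.TypeIliouvilleNoTypeII := by
  sorry

/-- STUB 3 (KNOWN, M–L to vendor — Type I for `u` ⇒ Type I for `curl u`).
CLOSED by name (ns-hhe-c1 g3, p621875; KNSS (4.10) at the Type-I zoom). -/
theorem stub_vorticityTypeI : VorticityTypeIOfTypeI :=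
  Summit.NavierStokesRegularity.NavierStokesRegularity.Theorems.EnstrophyQuarterLaw.LambBudget.vorticityTypeIOfTypeI

/-- STUB 4 (OPEN — THE NEW CRUX `B`: volume sparseness of the fast set for some `c₀ < 1`). -/
theorem stub_volumeSparseness : VolumeSparsenessLaw := by
  sorry

/-- STUB 5 (provable, S/M — measure × sup on the fast set). CLOSED by name (ns-hhe-c1 g3, p621507). -/
theorem stub_fastSetBudget : FastSetBudget :=
  Summit.NavierStokesRegularity.NavierStokesRegularity.Theorems.EnstrophyQuarterLaw.LambBudget.fastSetBudget

/-- STUB 6 (provable, S/M — Sobolev–Chebyshev converse). CLOSED by name (ns-hhe-c1 g3, p621487). -/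
theorem stub_volumeSparseOfSlice : VolumeSparseOfSlice :=
  Summit.NavierStokesRegularity.NavierStokesRegularity.Theorems.EnstrophyQuarterLaw.LambBudget.volumeSparseOfSlice

/-! ### Compositions (real proofs) -/

/-- `C⁺` from the wall, the known vorticity bound, the new crux `B` and the fast-set budget. -/
theorem lambBudgetQuarterLaw_of :
    Theses.TypeILiouville.TypeIliouvilleNoTypeII → VorticityTypeIOfTypeI → VolumeSparsenessLaw →
      FastSetBudget → LambBudgetQuarterLaw := by
  intro hII hω hV hF
  obtain ⟨c₀, hc₀, hc₁, hVS⟩ := hV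
  refine ⟨c₀, hc₀, hc₁, fun ν T hν hT u p hmax hLH hdec => ?_⟩
  have hTI : IsTypeIBlowup u T := hII ν T hν hT u p hmax hLH hdec
  exact hF c₀ hc₀ ν T hν hT u p hmax hLH hdec hTI (hω ν T hν hT u p hmax hLH hdec hTI)
    (hVS ν T hν hT u p hmax hLH hdec)

/-- **Skeleton theorem (forward).** The shelf crux BY NAME:
`EnstrophyQuarterLaw ⇐ slaving ∧ 0056 ∧ vorticity-Type-I ∧ VolumeSparsenessLaw ∧ fast-set budget`. -/
theorem EnstrophyQuarterLaw_of :
    EnstrophySlavedToIntenseLamb → Theses.TypeILiouville.TypeIliouvilleNoTypeII → VorticityTypeIOfTypeI →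
      VolumeSparsenessLaw → FastSetBudget → Theses.StretchingWellBinding.EnstrophyQuarterLaw := by
  intro hS hII hω hV hF ν T hν hT u p hmax hLH hdec
  obtain ⟨c₀, hc₀, hc₁, hLaw⟩ := lambBudgetQuarterLaw_of hII hω hV hF
  exact hS c₀ hc₀ hc₁ ν T hν hT u p hmax hLH hdec (hLaw ν T hν hT u p hmax hLH hdec)

/-- **Converse 1.** `EnstrophyQuarterLaw ⇒ B` at EVERY threshold `c₀ > 0` (so `B` is a consequence of
the quarter law, hence of the summit — lens «wuc»). -/
theorem volumeSparse_of_enstrophyQuarterLaw (hC : VolumeSparseOfSlice)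
    (hE : Theses.StretchingWellBinding.EnstrophyQuarterLaw) :
    ∀ c₀ : ℝ, 0 < c₀ →
      ∀ (ν T : ℝ), 0 < ν → 0 < T →
        ∀ (u : ℝ → EuclideanSpace ℝ (Fin 3) → EuclideanSpace ℝ (Fin 3)) (p : ℝ → EuclideanSpace ℝ (Fin 3) → ℝ),
        IsMaximalSmoothSolution ν 0 u p T → IsLerayHopfOn T ν 0 (u 0) u → HasRapidSpatialDecay (u 0) →
        VolumeSparse c₀ ν T u := by
  intro c₀ hc₀ ν T hν hT u p hmax hLH hdec
  obtain ⟨K, hK⟩ := hE ν T hν hT u p hmax hLH hdec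
  exact hC c₀ hc₀ ν T hν hT u p hmax hLH hdec ⟨K, hK⟩

/-- **Converse 2.** `EnstrophyQuarterLaw ⇒ C⁺`, via the PROVED record-time Type-I lemma
(`lerayQuarterDissipation_recordTimeTypeI_proof`, stmt-22145): the transfer is an EQUIVALENCE. -/
theorem lambBudgetQuarterLaw_of_enstrophyQuarterLaw (hω : VorticityTypeIOfTypeI) (hC : VolumeSparseOfSlice)
    (hF : FastSetBudget) (hE : Theses.StretchingWellBinding.EnstrophyQuarterLaw) : LambBudgetQuarterLaw := by
  refine ⟨1 / 2, by norm_num, by norm_num, fun ν T hν hT u p hmax hLH hdec => ?_⟩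
  obtain ⟨K, hK⟩ := hE ν T hν hT u p hmax hLH hdec
  have hTI : IsTypeIBlowup u T :=
    Summit.NavierStokesRegularity.NavierStokesRegularity.Theorems.lerayQuarterDissipation_recordTimeTypeI_proof
      ν T hν hT u p hmax.isClassicalNSSolutionOn hLH hdec K hK
  exact hF (1 / 2) (by norm_num) ν T hν hT u p hmax hLH hdec hTI (hω ν T hν hT u p hmax hLH hdec hTI)
    (hC (1 / 2) (by norm_num) ν T hν hT u p hmax hLH hdec ⟨K, hK⟩)

/-- **Headline, per solution.** For every `c₀ ∈ (0,1)`: quarter law ⟺ Type I ∧ volume sparseness of the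
fast set (modulo the provable stubs 1, 5, 6 and the known stub 3). -/
theorem sliceLaw_iff (hS : EnstrophySlavedToIntenseLamb) (hω : VorticityTypeIOfTypeI) (hF : FastSetBudget)
    (hC : VolumeSparseOfSlice) {c₀ : ℝ} (hc₀ : 0 < c₀) (hc₁ : c₀ < 1) {ν T : ℝ} (hν : 0 < ν) (hT : 0 < T)
    {u : ℝ → EuclideanSpace ℝ (Fin 3) → EuclideanSpace ℝ (Fin 3)} {p : ℝ → EuclideanSpace ℝ (Fin 3) → ℝ}
    (hmax : IsMaximalSmoothSolution ν 0 u p T) (hLH : IsLerayHopfOn T ν 0 (u 0) u)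
    (hdec : HasRapidSpatialDecay (u 0)) :
    SliceLaw T u ↔ (IsTypeIBlowup u T ∧ VolumeSparse c₀ ν T u) := by
  constructor
  · rintro ⟨K, hK⟩
    have hTI : IsTypeIBlowup u T :=
      Summit.NavierStokesRegularity.NavierStokesRegularity.Theorems.lerayQuarterDissipation_recordTimeTypeI_proof
        ν T hν hT u p hmax.isClassicalNSSolutionOn hLH hdec K hK
    exact ⟨hTI, hC c₀ hc₀ ν T hν hT u p hmax hLH hdec ⟨K, hK⟩⟩
  · rintro ⟨hTI, hV⟩
    exact hS c₀ hc₀ hc₁ ν T hν hT u p hmax hLH hdec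
      (hF c₀ hc₀ ν T hν hT u p hmax hLH hdec hTI (hω ν T hν hT u p hmax hLH hdec hTI) hV)

/-- **PROVED (no sorry): weak-`L³` at one level is volume sparseness.** If `sup_{t<T} ‖u(t)‖³_{L^{3,∞}} ≤ M'`
(`eWeakLpPow (u t) 3 volume ≤ ofReal M'`, the conclusion of TIQG's `LorentzUpgradeTypeI`), then for every
`c₀ > 0` the fast set is volume sparse with `N = M'⁺/(c₀³ν³)`: Chebyshev at the single level
`λ = c₀√(ν/(T−s))`, and `λ·√(ν(T−s)) = c₀ν`. -/
theorem volumeSparse_of_weakL3 {c₀ ν T : ℝ} (hc₀ : 0 < c₀) (hν : 0 < ν)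
    {u : ℝ → EuclideanSpace ℝ (Fin 3) → EuclideanSpace ℝ (Fin 3)} {M' : ℝ}
    (hM : ∀ t ∈ Set.Ico 0 T,
      Literature.Analysis.FunctionSpaces.eWeakLpPow (u t) 3 volume ≤ ENNReal.ofReal M') :
    VolumeSparse c₀ ν T u := by
  refine ⟨max M' 0 / (c₀ ^ 3 * ν ^ 3), fun s hs => ?_⟩
  have hTs : 0 < T - s := sub_pos.2 hs.2
  have hS : 0 < Real.sqrt (ν * (T - s)) := Real.sqrt_pos.2 (mul_pos hν hTs)
  have hlam_pos : 0 < c₀ * Real.sqrt (ν / (T - s)) :=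
    mul_pos hc₀ (Real.sqrt_pos.2 (div_pos hν hTs))
  -- key algebra: `λ · √(ν(T−s)) = c₀ ν`
  have hkey : c₀ * Real.sqrt (ν / (T - s)) * Real.sqrt (ν * (T - s)) = c₀ * ν := by
    rw [mul_assoc, ← Real.sqrt_mul (div_pos hν hTs).le]
    congr 1
    rw [show ν / (T - s) * (ν * (T - s)) = ν ^ 2 by field_simp]
    exact Real.sqrt_sq hν.le
  have hlam_eq : c₀ * Real.sqrt (ν / (T - s)) = c₀ * ν / Real.sqrt (ν * (T - s)) := by
    rw [eq_div_iff hS.ne']; exact hkey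
  -- the level inequality of the weak-`L³` bound at `t = λ`
  have hlev := (Literature.Analysis.FunctionSpaces.rpow_mul_meas_lt_le_eWeakLpPow (u s) 3 volume
    (c₀ * Real.sqrt (ν / (T - s))).toNNReal).trans (hM s hs)
  have hset : {x | (((c₀ * Real.sqrt (ν / (T - s))).toNNReal : ℝ≥0) : ℝ≥0∞) < ‖u s x‖ₑ}
      = fastSet c₀ ν T u s := by
    ext x
    simp only [fastSet, Set.mem_setOf_eq, enorm_eq_nnnorm, ENNReal.coe_lt_coe, ← NNReal.coe_lt_coe,
      Real.coe_toNNReal _ hlam_pos.le, coe_nnnorm]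
  have h3 : (3 : ℝ≥0∞).toReal = ((3 : ℕ) : ℝ) := by norm_num
  have hcoe : (((c₀ * Real.sqrt (ν / (T - s))).toNNReal : ℝ≥0) : ℝ≥0∞) ^ ((3 : ℕ) : ℝ)
      = ENNReal.ofReal ((c₀ * Real.sqrt (ν / (T - s))) ^ 3) := by
    rw [ENNReal.rpow_natCast, ENNReal.ofReal, Real.toNNReal_pow hlam_pos.le, ENNReal.coe_pow]
  rw [hset, h3, hcoe] at hlev
  have hlam3 : 0 < (c₀ * Real.sqrt (ν / (T - s))) ^ 3 := pow_pos hlam_pos 3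
  have hF : volume (fastSet c₀ ν T u s) ≤
      ENNReal.ofReal M' / ENNReal.ofReal ((c₀ * Real.sqrt (ν / (T - s))) ^ 3) := by
    rw [ENNReal.le_div_iff_mul_le (Or.inl (ENNReal.ofReal_pos.2 hlam3).ne') (Or.inl ENNReal.ofReal_ne_top)]
    rwa [mul_comm] at hlev
  refine hF.trans ?_
  rw [← ENNReal.ofReal_div_of_pos hlam3]
  apply ENNReal.ofReal_le_ofReal
  have hcν : 0 < (c₀ * ν) ^ 3 := by positivity
  calc M' / (c₀ * Real.sqrt (ν / (T - s))) ^ 3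
        = M' * Real.sqrt (ν * (T - s)) ^ 3 / (c₀ * ν) ^ 3 := by
          rw [hlam_eq, div_pow, div_div_eq_mul_div]
    _ ≤ max M' 0 * Real.sqrt (ν * (T - s)) ^ 3 / (c₀ * ν) ^ 3 := by
          gcongr
          exact le_max_left _ _
    _ = max M' 0 / (c₀ ^ 3 * ν ^ 3) * Real.sqrt (ν * (T - s)) ^ 3 := by
          rw [mul_pow]; ring

/-- **COROLLARY for route TypeIQuarterGate.** Its deciding crux `QuarterLawTypeI` (stmt-23726) from its
own rank-4 crux `LorentzUpgradeTypeI` (stmt-24108) DIRECTLY — weak-`L³` at one level is volume sparseness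
(`volumeSparse_of_weakL3`, proved), and Type I + volume sparseness is the quarter law by the Lamb slaving
(stubs 1, 3, 5: provable, known, provable). No scar count, no envelope, no profile, no Liouville. -/
theorem quarterLawTypeI_of_lorentzUpgrade (hS : EnstrophySlavedToIntenseLamb) (hω : VorticityTypeIOfTypeI)
    (hF : FastSetBudget) (hL : Theses.TypeIQuarterGate.LorentzUpgradeTypeI) :
    Theses.TypeIQuarterGate.QuarterLawTypeI := by
  intro ν T hν hT u p hmax hLH hdec hTI
  obtain ⟨M', hM⟩ := hL ν T hν hT u p hmax hLH hdec hTI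
  exact hS (1 / 2) (by norm_num) (by norm_num) ν T hν hT u p hmax hLH hdec
    (hF (1 / 2) (by norm_num) ν T hν hT u p hmax hLH hdec hTI (hω ν T hν hT u p hmax hLH hdec hTI)
      (volumeSparse_of_weakL3 (by norm_num) hν hM))

/-- The same corollary at shelf level: `EnstrophyQuarterLaw ⇐ 0056 ∧ 24108 ∧ [stubs 1, 3, 5]`. -/
theorem enstrophyQuarterLaw_of_noTypeII_of_lorentzUpgrade (hS : EnstrophySlavedToIntenseLamb)
    (hω : VorticityTypeIOfTypeI) (hF : FastSetBudget)
    (hII : Theses.TypeILiouville.TypeIliouvilleNoTypeII) (hL : Theses.TypeIQuarterGate.LorentzUpgradeTypeI) :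
    Theses.StretchingWellBinding.EnstrophyQuarterLaw := by
  intro ν T hν hT u p hmax hLH hdec
  exact quarterLawTypeI_of_lorentzUpgrade hS hω hF hL ν T hν hT u p hmax hLH hdec
    (hII ν T hν hT u p hmax hLH hdec)

/-- The stubs, used by name (so the registered stub set is exactly the cone of the compositions). -/
theorem enstrophyQuarterLaw_holds_of_stubs : Theses.StretchingWellBinding.EnstrophyQuarterLaw :=
  EnstrophyQuarterLaw_of stub_enstrophySlavedToIntenseLamb stub_noTypeII stub_vorticityTypeI
    stub_volumeSparseness stub_fastSetBudget

theorem lambBudgetQuarterLaw_iff_of_stubs :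
    LambBudgetQuarterLaw ↔ Theses.StretchingWellBinding.EnstrophyQuarterLaw :=
  ⟨fun h => by
      obtain ⟨c₀, hc₀, hc₁, hLaw⟩ := h
      exact fun ν T hν hT u p hmax hLH hdec =>
        stub_enstrophySlavedToIntenseLamb c₀ hc₀ hc₁ ν T hν hT u p hmax hLH hdec
          (hLaw ν T hν hT u p hmax hLH hdec),
    lambBudgetQuarterLaw_of_enstrophyQuarterLaw stub_vorticityTypeI stub_volumeSparseOfSlice stub_fastSetBudget⟩

end Summit.NavierStokesRegularity.NavierStokesRegularity.Cruxes.EnstrophyQuarterLaw.LambBudget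

end
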